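import Literature.Probability.RandomPlanarGeometry.YangBaxterSAWTwoPoint
import Literature.Probability.RandomPlanarGeometry.YangBaxterSAWFacts
import Mathlib.Analysis.PSeries
import Mathlib.Analysis.SpecialFunctions.Pow.Real
import HarnessLib

/-!
# Glazman–Manolescu, Proposition 1.1 as printed: `Σ_T (B_T(π/3))³ / T < ∞`

Topic `Literature/Probability/RandomPlanarGeometry`: A. Glazman, I. Manolescu, *Self-avoiding
walk on `ℤ²` with Yang–Baxter weights: universality of critical fugacity and 2-point function*,
Ann. Inst. Henri Poincaré Probab. Stat. 56 (2020) 2281–2300, arXiv:1708.00395 (bib key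
`GlazmanManolescu2019`), **Proposition 1.1** (p. 4 of the arXiv version; the statement is word for
word the same in arXiv v1 (2017), v3 (2019) and the journal):

> "Proposition 1.1. We have `Σ_{T ≥ 1} (1/T) (B_T(π/3))³ < ∞`. (3)
> As a consequence, the partition function of self-avoiding bridges on the hexagonal lattice
> vanishes at infinity: `B_T(π/3) → 0` as `T → ∞`. Moreover `B_T(π/3) < 1/(log T)^{1/3}` for
> infinitely many values of `T`."

Here `B_T(π/3) = B_{T,Θ}` for the constant sequence `Θ ≡ π/3` is the partition function (2) of
bridges of `Strip_T` (`bridgePartitionFunction T (fun _ => π / 3)` of `YangBaxterSAW.lean`), i.e.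
of self-avoiding bridges of the hexagonal lattice at `x_c = 1/√(2+√2)`.

## Why this file exists (a mis-quotation of Proposition 1.1)

The named fact `GlazmanManolescu2019_prop11` of `YangBaxterSAWFacts.lean` (moved there verbatim out of
the definitions file `YangBaxterSAW.lean`, module split `defn-YangBaxterSAWFacts`) renders Proposition 1.1 as
"`Σ_{T ≥ 1} B_{T,π/3} / T < ∞`", WITHOUT the cube. That is not what the source states or proves:
the printed inequality (3) carries `(B_T)³`, and the cube is intrinsic to the proof (§4.1:
three walks in nested equilateral triangles, rotated by `0`, `π/3`, `2π/3`, are concatenated into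
one arc, whence `Σ_{k=L}^{9L} G(0,k) ≥ (1/8)(D^Δ_{4L})³` and `Σ_T (D^Δ_T)³/T ≤ 64 Σ_k G(0,k) < ∞`).
Since `B_T ≤ 1` (Corollary 2.3), the cube-free statement is STRONGER than (3)
(`GlazmanManolescu2019_prop11_cube_of_prop11` below); it is consistent with the conjectured
polynomial decay of `B_T`, but we could not find it proved anywhere ([BBDDG] prove `B_T → 0`,
Glazman–Manolescu prove (3), nothing sharper is claimed in either).

The CORRECT rendering of eq. (3) in the conventions of `YangBaxterSAW.lean` (partition functions
`ℝ≥0∞`-valued, widths `T + 1`, `T : ℕ`) is the proposition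

    (∑' T : ℕ, bridgePartitionFunction (T + 1) (fun _ => π / 3) ^ 3 / (T + 1 : ℝ≥0∞)) < ⊤

(to be vendored as the named fact `GlazmanManolescu2019_prop11_cube` by a citation seat; a
fact-proving seat may not mint new named facts, D-0026, so this file states it only as an
explicit HYPOTHESIS of the theorems below). Its proof in the source is the parafermionic
observable summed over equilateral triangles inscribed in the strip (Lemma 4.1:
`B_{2L+1} ≤ cos(π/8) D^Δ_{2L+1}`, `D^Δ` non-increasing) plus the rotational symmetry of the
hexagonal lattice; it is not formalised.

## Contents (all PROVED; the cube series (3) enters as a hypothesis `h3`)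

* `GlazmanManolescu2019_prop11_limit_of_cube` — **"As a consequence, … `B_T(π/3) → 0`"**: (3) and
  Corollary 2.3 imply the named fact `GlazmanManolescu2019_prop11_limit` of
  `YangBaxterSAWTwoPoint.lean` (the only part of Prop. 1.1 used by Theorems 1 and 2): by
  `cos(3π/8) A_T + B_T = 1` and `A_T ≤ A_{T+1}`, `T ↦ B_T` is non-increasing
  (`bridgePartitionFunction_succ_le`), and a non-increasing sequence with `Σ_T B_T³/T < ∞` tends
  to `0` (the paper runs the same argument with the monotone majorant `D^Δ_T ≥ B_T/cos(π/8)` of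
  Lemma 4.1 instead of Corollary 2.3);
* `GlazmanManolescu2019_prop11_logBound_of_cube` — **"Moreover `B_T(π/3) < 1/(log T)^{1/3}` for
  infinitely many values of `T`"** from (3), exactly as printed ("this implies in particular that
  the summand … is smaller than `1/log T` for infinitely many values of `T`" — the wording of arXiv v2,
  proof of Proposition 1.1 in §4.1, PDF p. 13; arXiv v3 (2019), §4.1, PDF pp. 12–14, keeps only the next
  sentence, "(`D^Δ_T (log T)^{1/3}`)_T contains a subsequence converging to `0`", p. 14): otherwise (3)
  would dominate the divergent series `Σ 1/(T log T)` (`not_summable_one_div_natCast_mul_log`);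
* `GlazmanManolescu2019_prop11_cube_of_prop11` — the mis-quoted `GlazmanManolescu2019_prop11`
  implies (3) (given Corollary 2.3, `B_T ≤ 1`), documenting that it is the stronger statement;
* `arcPartitionFunction_mono` (`A_T ≤ A_{T+1}`), `bridgePartitionFunction_le_one` (`B_T ≤ 1`) and
  `bridgePartitionFunction_succ_le` (`B_{T+1} ≤ B_T`), both from Cor. 2.3;
  `tsum_inv_natCast_succ_eq_top` (`Σ_T 1/(T+1) = ∞` in `ℝ≥0∞`) and
  `not_summable_one_div_natCast_mul_log` (`Σ_n 1/(n log n) = ∞`, Cauchy condensation), two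
  folklore lemmas kept in this file's namespace (not Mathlib's).
-/

noncomputable section

open Real Filter
open _root_.Topology
open scoped ENNReal NNReal

namespace Literature.Probability.RandomPlanarGeometry.SAW.YangBaxter

/-! ### Two divergent series -/

/-- **The harmonic series diverges** in `ℝ≥0∞`: `Σ_{T ≥ 0} 1/(T+1) = ∞`. [folklore] -/
theorem tsum_inv_natCast_succ_eq_top : (∑' T : ℕ, ((T : ℝ≥0∞) + 1)⁻¹) = ⊤ := by
  have h : ∀ T : ℕ, ((T : ℝ≥0∞) + 1)⁻¹ = ((((T : ℝ≥0) + 1)⁻¹ : ℝ≥0) : ℝ≥0∞) := by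
    intro T
    rw [ENNReal.coe_inv (by positivity), ENNReal.coe_add, ENNReal.coe_natCast, ENNReal.coe_one]
  simp_rw [h]
  rw [ENNReal.tsum_coe_eq_top_iff_not_summable_coe]
  intro hs
  refine Real.not_summable_natCast_inv ((summable_nat_add_iff 1).1 ?_)
  simpa [Nat.cast_add, Nat.cast_one] using hs

/-- **`Σ_n 1/(n log n)` diverges** (Cauchy condensation: the condensed series is the harmonic
series divided by `log 2`; the terms `n = 0, 1` are `1/0 = 0`). [folklore] -/
theorem not_summable_one_div_natCast_mul_log :
    ¬Summable (fun n : ℕ => 1 / ((n : ℝ) * Real.log n)) := by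
  have h_nonneg : 0 ≤ᶠ[atTop] fun n : ℕ => 1 / ((n : ℝ) * Real.log n) := by
    filter_upwards [eventually_ge_atTop 1] with n hn
    have : (0 : ℝ) ≤ Real.log n := Real.log_nonneg (by exact_mod_cast hn)
    positivity
  have h_mono : ∀ᶠ k : ℕ in atTop,
      1 / (((k + 1 : ℕ) : ℝ) * Real.log ((k + 1 : ℕ) : ℝ)) ≤ 1 / ((k : ℝ) * Real.log k) := by
    filter_upwards [eventually_ge_atTop 2] with k hk
    have hk1 : (1 : ℝ) < k := by exact_mod_cast hk
    have hlogk : 0 < Real.log k := Real.log_pos hk1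
    have hkk : (k : ℝ) ≤ ((k + 1 : ℕ) : ℝ) := by exact_mod_cast Nat.le_succ k
    refine one_div_le_one_div_of_le (by positivity) ?_
    exact mul_le_mul hkk (Real.log_le_log (by positivity) hkk) hlogk.le (by positivity)
  rw [← summable_condensed_iff_of_eventually_nonneg h_nonneg h_mono]
  have hlog2 : Real.log 2 ≠ 0 := (Real.log_pos one_lt_two).ne'
  have h : (fun k : ℕ => (2 : ℝ) ^ k * (1 / (((2 ^ k : ℕ) : ℝ) * Real.log ((2 ^ k : ℕ) : ℝ)))) =
      fun k : ℕ => (k : ℝ)⁻¹ * (Real.log 2)⁻¹ := by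
    ext k
    have h2 : (2 : ℝ) ^ k ≠ 0 := pow_ne_zero _ two_ne_zero
    rw [Nat.cast_pow, Nat.cast_two, Real.log_pow, one_div, mul_inv, mul_inv, ← mul_assoc,
      ← mul_assoc, mul_inv_cancel₀ h2, one_mul]
  rw [h, summable_mul_right_iff (inv_ne_zero hlog2)]
  exact Real.not_summable_natCast_inv

/-! ### Monotonicity in the width (from Corollary 2.3) -/

/-- `T ↦ A_{T,Θ}` is non-decreasing ("all walks contributing to `A_T` also contribute to `A_{T+1}`").
[cite: GlazmanManolescu2019, §4.1 (proof of Lemma 4.1) and §4.2] -/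
theorem arcPartitionFunction_mono (Θ : ℤ → ℝ) : Monotone fun T : ℕ => arcPartitionFunction T Θ := by
  intro T T' h
  refine ENNReal.tsum_le_tsum fun L => ?_
  split_ifs
  · exact le_rfl
  · exact twoPoint_strip_mono Θ _ _ h

/-- **`B_{T,Θ} ≤ 1`** for `T ≥ 1`, from `cos(3π/8) A_{T,Θ} + B_{T,Θ} = 1` (Corollary 2.3).
[cite: GlazmanManolescu2019, Corollary 2.3] -/
theorem bridgePartitionFunction_le_one (h23 : GlazmanManolescu2019_cor23) {Θ : ℤ → ℝ}
    (hΘ : ∀ k, Θ k ∈ Set.Icc (π / 3) (2 * π / 3)) {T : ℕ} (hT : 1 ≤ T) :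
    bridgePartitionFunction T Θ ≤ 1 :=
  (h23 Θ hΘ T hT) ▸ le_add_self

/-- **`T ↦ B_{T,Θ}` is non-increasing** (`T ≥ 1`): `B_T = 1 − cos(3π/8) A_T` by Corollary 2.3 and
`A_T ≤ A_{T+1}`. [cite: GlazmanManolescu2019, Corollary 2.3 and §4.1 (proof of Lemma 4.1)] -/
theorem bridgePartitionFunction_succ_le (h23 : GlazmanManolescu2019_cor23) {Θ : ℤ → ℝ}
    (hΘ : ∀ k, Θ k ∈ Set.Icc (π / 3) (2 * π / 3)) {T : ℕ} (hT : 1 ≤ T) :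
    bridgePartitionFunction (T + 1) Θ ≤ bridgePartitionFunction T Θ := by
  have h1 := h23 Θ hΘ T hT
  have h2 := h23 Θ hΘ (T + 1) (by omega)
  set c := ENNReal.ofReal (Real.cos (3 * π / 8))
  have hA : c * arcPartitionFunction T Θ ≤ c * arcPartitionFunction (T + 1) Θ := by
    gcongr
    exact arcPartitionFunction_mono Θ (Nat.le_succ T)
  calc bridgePartitionFunction (T + 1) Θ = 1 - c * arcPartitionFunction (T + 1) Θ :=
        ENNReal.eq_sub_of_add_eq' ENNReal.one_ne_top (by rw [add_comm]; exact h2)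
    _ ≤ 1 - c * arcPartitionFunction T Θ := tsub_le_tsub_left hA 1
    _ = bridgePartitionFunction T Θ := by
        rw [← h1, add_comm, ENNReal.add_sub_cancel_right]
        exact ne_top_of_le_ne_top ENNReal.one_ne_top (h1 ▸ le_self_add)

/-! ### The consequences printed in Proposition 1.1 -/

/-- **"As a consequence, … `B_T(π/3) → 0`"**: eq. (3) (the hypothesis `h3`, Proposition 1.1 as
printed) and Corollary 2.3 imply `GlazmanManolescu2019_prop11_limit`. A non-increasing sequence (`bridgePartitionFunction_succ_le`)
converges to its infimum `β`; if `β > 0` then `Σ_T B_T³/T ≥ β³ Σ_T 1/T = ∞`, contradicting (3).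
(The source argues identically with the monotone majorant `D^Δ_T` of Lemma 4.1.)
[cite: GlazmanManolescu2019, Proposition 1.1 (proof, §4.1; arXiv:1708.00395v3 pp. 12–14, Lemma 4.1 on p. 12, conclusion on p. 14; arXiv v2 pp. 11–13)] -/
theorem GlazmanManolescu2019_prop11_limit_of_cube (h23 : GlazmanManolescu2019_cor23)
    (h3 : (∑' T : ℕ, bridgePartitionFunction (T + 1) (fun _ => π / 3) ^ 3 / (T + 1 : ℝ≥0∞)) < ⊤) :
    GlazmanManolescu2019_prop11_limit := by
  have hhex : ∀ k : ℤ, (fun _ => π / 3 : ℤ → ℝ) k ∈ Set.Icc (π / 3) (2 * π / 3) :=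
    fun _ => pi_div_three_mem_Icc
  set B : ℕ → ℝ≥0∞ := fun T => bridgePartitionFunction (T + 1) (fun _ => π / 3) with hB
  have hanti : Antitone B :=
    antitone_nat_of_succ_le fun T => bridgePartitionFunction_succ_le h23 hhex (by omega)
  have hlim : Tendsto B atTop (𝓝 (⨅ T, B T)) := tendsto_atTop_iInf hanti
  suffices h0 : (⨅ T, B T) = 0 by
    rw [h0] at hlim
    exact (tendsto_add_atTop_iff_nat 1).1 hlim
  by_contra hβ
  refine h3.ne (top_unique ?_)
  calc (⊤ : ℝ≥0∞) = (⨅ T, B T) ^ 3 * ∑' T : ℕ, ((T : ℝ≥0∞) + 1)⁻¹ := by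
        rw [tsum_inv_natCast_succ_eq_top, ENNReal.mul_top (pow_ne_zero 3 hβ)]
    _ = ∑' T : ℕ, (⨅ T, B T) ^ 3 * ((T : ℝ≥0∞) + 1)⁻¹ := ENNReal.tsum_mul_left.symm
    _ ≤ ∑' T : ℕ, B T ^ 3 / (T + 1 : ℝ≥0∞) := by
        refine ENNReal.tsum_le_tsum fun T => ?_
        rw [div_eq_mul_inv]
        gcongr
        exact iInf_le B T

/-- **"Moreover `B_T(π/3) < 1/(log T)^{1/3}` for infinitely many values of `T`"** (the last clause
of Proposition 1.1, as printed; for `T ≤ 1` the bound reads `1/0 = 0` and is void) follows from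
eq. (3) (the hypothesis `h3`): otherwise `B_T³/T ≥ 1/(T log T)` for all large `T`, and
`Σ 1/(T log T) = ∞`.
[cite: GlazmanManolescu2019, Proposition 1.1 (statement p. 4; proof §4.1, arXiv:1708.00395v3 pp. 12–14, the subsequence statement on p. 14; arXiv v2 p. 13)] -/
theorem GlazmanManolescu2019_prop11_logBound_of_cube
    (h3 : (∑' T : ℕ, bridgePartitionFunction (T + 1) (fun _ => π / 3) ^ 3 / (T + 1 : ℝ≥0∞)) < ⊤) :
    ∃ᶠ T : ℕ in atTop,
      bridgePartitionFunction T (fun _ => π / 3) < ENNReal.ofReal (1 / Real.log T ^ (1 / 3 : ℝ)) := by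
  by_contra hcon
  rw [Filter.not_frequently, eventually_atTop] at hcon
  obtain ⟨T₀, hT₀⟩ := hcon
  -- the comparison series `g T = 1/(T log T)` for `T ≥ T₁ := max T₀ 2`, `0` before
  set T₁ : ℕ := max T₀ 2 with hT₁
  set g : ℕ → ℝ := fun T => if T₁ ≤ T then 1 / ((T : ℝ) * Real.log T) else 0 with hg
  have hg_nonneg : ∀ T, 0 ≤ g T := by
    intro T
    simp only [hg]
    split_ifs with hT
    · have : (0 : ℝ) ≤ Real.log T := Real.log_nonneg (by exact_mod_cast le_of_max_le_right hT |>.trans' (by norm_num))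
      positivity
    · exact le_rfl
  -- `g` is not summable, hence neither is its shift by one
  have hg_ns : ¬Summable fun T : ℕ => g (T + 1) := by
    rw [summable_nat_add_iff 1]
    intro hs
    refine not_summable_one_div_natCast_mul_log (hs.congr_atTop ?_)
    filter_upwards [eventually_ge_atTop T₁] with T hT
    simp [hg, hT]
  -- hence `Σ_T ofReal (g (T+1)) = ⊤`
  have hg_top : (∑' T : ℕ, ENNReal.ofReal (g (T + 1))) = ⊤ := by
    have : ∀ T : ℕ, ENNReal.ofReal (g (T + 1)) = (((g (T + 1)).toNNReal : ℝ≥0) : ℝ≥0∞) := fun T => rfl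
    simp_rw [this]
    rw [ENNReal.tsum_coe_eq_top_iff_not_summable_coe]
    simpa only [Real.coe_toNNReal _ (hg_nonneg _)] using hg_ns
  -- termwise comparison `ofReal (g (T+1)) ≤ B_{T+1}³/(T+1)`
  have hcmp : ∀ T : ℕ, ENNReal.ofReal (g (T + 1)) ≤
      bridgePartitionFunction (T + 1) (fun _ => π / 3) ^ 3 / (T + 1 : ℝ≥0∞) := by
    intro T
    simp only [hg]
    split_ifs with hT
    · have hT2 : 2 ≤ T + 1 := le_of_max_le_right hT
      have hT0 : T₀ ≤ T + 1 := le_of_max_le_left hT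
      have hlog : 0 < Real.log ((T + 1 : ℕ) : ℝ) := Real.log_pos (by exact_mod_cast hT2)
      have hB := hT₀ (T + 1) hT0
      rw [not_lt] at hB
      -- cube the bound
      have hB3 : ENNReal.ofReal (1 / Real.log ((T + 1 : ℕ) : ℝ)) ≤
          bridgePartitionFunction (T + 1) (fun _ => π / 3) ^ 3 := by
        calc ENNReal.ofReal (1 / Real.log ((T + 1 : ℕ) : ℝ))
            = ENNReal.ofReal ((1 / Real.log ((T + 1 : ℕ) : ℝ) ^ (1 / 3 : ℝ)) ^ 3) := by
              congr 1
              rw [one_div_pow, ← Real.rpow_natCast, ← Real.rpow_mul hlog.le]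
              norm_num
          _ = ENNReal.ofReal (1 / Real.log ((T + 1 : ℕ) : ℝ) ^ (1 / 3 : ℝ)) ^ 3 := by
              rw [ENNReal.ofReal_pow (by positivity)]
          _ ≤ bridgePartitionFunction (T + 1) (fun _ => π / 3) ^ 3 := by
              gcongr
      calc ENNReal.ofReal (1 / (((T + 1 : ℕ) : ℝ) * Real.log ((T + 1 : ℕ) : ℝ)))
          = ENNReal.ofReal (1 / Real.log ((T + 1 : ℕ) : ℝ)) / (T + 1 : ℝ≥0∞) := by
            rw [mul_comm, ← div_div, ENNReal.ofReal_div_of_pos (by positivity)]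
            congr 1
            push_cast
            rw [ENNReal.ofReal_add (by positivity) zero_le_one, ENNReal.ofReal_natCast,
              ENNReal.ofReal_one]
        _ ≤ bridgePartitionFunction (T + 1) (fun _ => π / 3) ^ 3 / (T + 1 : ℝ≥0∞) := by
            gcongr
    · simp
  refine h3.ne (top_unique ?_)
  calc (⊤ : ℝ≥0∞) = ∑' T : ℕ, ENNReal.ofReal (g (T + 1)) := hg_top.symm
    _ ≤ _ := ENNReal.tsum_le_tsum hcmp

/-! ### The mis-quoted statement is stronger -/

/-- The cube-free statement `GlazmanManolescu2019_prop11` of `YangBaxterSAWFacts.lean`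
(`Σ_T B_T/T < ∞`, NOT what the source proves) implies the printed eq. (3), since `B_T ≤ 1`
(Corollary 2.3) gives `B_T³ ≤ B_T`. Recorded to document the discrepancy; the converse
implication is not known. [cite: GlazmanManolescu2019, Proposition 1.1, eq. (3) and Corollary 2.3] -/
theorem GlazmanManolescu2019_prop11_cube_of_prop11 (h23 : GlazmanManolescu2019_cor23)
    (h : GlazmanManolescu2019_prop11) :
    (∑' T : ℕ, bridgePartitionFunction (T + 1) (fun _ => π / 3) ^ 3 / (T + 1 : ℝ≥0∞)) < ⊤ := by
  have hhex : ∀ k : ℤ, (fun _ => π / 3 : ℤ → ℝ) k ∈ Set.Icc (π / 3) (2 * π / 3) :=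
    fun _ => pi_div_three_mem_Icc
  refine lt_of_le_of_lt (ENNReal.tsum_le_tsum fun T => ?_) h
  gcongr
  have h1 : bridgePartitionFunction (T + 1) (fun _ => π / 3) ≤ 1 :=
    bridgePartitionFunction_le_one h23 hhex (by omega)
  calc bridgePartitionFunction (T + 1) (fun _ => π / 3) ^ 3
      = bridgePartitionFunction (T + 1) (fun _ => π / 3) ^ 2 *
          bridgePartitionFunction (T + 1) (fun _ => π / 3) := pow_succ _ 2
    _ ≤ 1 ^ 2 * bridgePartitionFunction (T + 1) (fun _ => π / 3) := by gcongr
    _ = bridgePartitionFunction (T + 1) (fun _ => π / 3) := by rw [one_pow, one_mul]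

end Literature.Probability.RandomPlanarGeometry.SAW.YangBaxter
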